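import Mathlib
import HarnessLib
import Literature.AlgebraicGeometry.Surfaces.K3Surface
import Literature.AlgebraicGeometry.Motives.SegreEmbedding

/-!
# K3 surfaces with complex multiplication: the Hodge conjecture for `S × S` (Buskin; Huybrechts)

Family `hodge`, layer `Literature/AlgebraicGeometry/Surfaces`, on top of `K3Surface.lean`
(`IsK3Surface`, Buskin's theorem `Buskin2019_hodgeIsometry_algebraic`) and the REAL carriers of the
tree (`complexBetti`, `IsRationalClass`, `IsOfHodgeType`, `HodgeConjectureFor`, the fibre product
`S ⊗ S` in `Motives.SchemeOver ℂ`). Consumer: route HodgeConjecture/EvenB2Twistor (item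
`HighPicardSquares`, the CM case of "HC(S × S) for Picard number `≥ 17`").
Sources read, verbatim:

* N. Buskin, *Every rational Hodge isometry between two K3 surfaces is algebraic*, J. reine
  angew. Math. 755 (2019), arXiv:1510.02852, §1, after Thm. 1.1: "**Corollary.** If `S` is an
  algebraic K3 surface for which the endomorphism field of its transcendental Hodge structure is a
  CM-field then the Hodge conjecture is true for `S × S`. Indeed, by [RM] and [Zarhin] when the
  endomorphism field of `T(S)_ℚ` is a CM-field, it is spanned over `ℚ` by Hodge isometries of
  `T(S)_ℚ`. Thus, by Theorem 1.1 every Hodge endomorphism of `T(S)_ℚ` is algebraic."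
* D. Huybrechts, *Motives of isogenous K3 surfaces*, Comment. Math. Helv. 94 (2019),
  arXiv:1705.04063, Introduction, Corollary 0.4 (labelled "Corollary (Buskin)"): "(ii) If `S` is a
  complex projective K3 surface with complex multiplication, i.e. `End_Hdg(T(S) ⊗ ℚ)` is a
  CM-field, then the Hodge conjecture holds for `S × S`"; §3, Remark 3.3: "According to [Zarhin],
  the endomorphism field `End_Hdg(T(S) ⊗ ℚ)` of the rational Hodge structure `T(S) ⊗ ℚ` is either
  totally real or has complex multiplication. … In case of CM, the endomorphism field is spanned by
  Hodge isometries cf. [HuyK3], which is enough to prove Corollary 0.4 (ii)".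
* D. Huybrechts, *Lectures on K3 Surfaces* (CUP 2016), Ch. 3: Lemma 3.3.1 (`T(X) = NS(X)^⊥`; "If
  `X` is projective, then `T(X)` is a polarizable irreducible Hodge structure"), Cor. 3.3.6 (the
  action on `T^{2,0}` is an injective `ℚ`-algebra map `ε : K = End_Hdg(T) → ℂ`, `K` a number
  field), Thm. 3.3.7 (Zarhin: "`K` is either totally real or a CM field"), §3.3.3 p. 65 (totally
  real = all embeddings real; CM = purely imaginary quadratic extension of a totally real field),
  Rem. 3.3.10 (the STRONGER notion "`Hdg(T)` commutative ⇔ `dim_K T = 1`" of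
  Pjateckiĭ-Šapiro–Šafarevič is NOT the one meant here).

## Lean rendering (one named fact, D-0014)

* `HasComplexMultiplication S` — "`End_Hdg(T(S) ⊗ ℚ)` is a CM field", rendered WITHOUT the
  transcendental lattice as: some endomorphism `ψ` of `H²(S(ℂ); ℂ)` preserving rational classes and
  Hodge types (a rational Hodge endomorphism, the spelling of route EvenB2Twistor) acts on a
  non-zero `(2,0)`-class by a NON-REAL scalar. Justification for a complex projective K3 surface:
  `H²(S, ℚ) = NS_ℚ ⊕ T_ℚ` as Hodge structures with `T_ℚ` irreducible of K3 type (Lemma 3.3.1), so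
  `End_Hdg(T_ℚ)` consists of the restrictions `pr_T ∘ ψ|_T` of the Hodge endomorphisms `ψ` of
  `H²(S, ℚ)` (conversely extend `a ∈ End_Hdg(T_ℚ)` by `0` on `NS`); `K = End_Hdg(T_ℚ)` is a
  number field embedded in `ℂ` by its action `ε` on `T^{2,0} = H^{2,0}(S)` (Cor. 3.3.6) and is
  totally real or CM (Zarhin, Thm. 3.3.7); totally real forces `ε(K) ⊂ ℝ`, a CM field has no real
  embedding — so "`K` is CM `⇔ ε(a) ∉ ℝ` for some `a`", the displayed condition.
* `Buskin2019_hodgeConjectureFor_square_of_CM` — the Corollary as printed: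
  `IsK3Surface S → HasComplexMultiplication S → HodgeConjectureFor 4 (S ⊗ S)`.

## Not here (deliberately)

Buskin's Thm. 1.1 itself (`K3Surface.lean`: `Buskin2019_hodgeIsometry_algebraic`); the lemma "a CM
endomorphism field is spanned by Hodge isometries" and the Künneth / Lefschetz `(1,1)` bookkeeping
deriving the Corollary from Thm. 1.1 (the Corollary is vendored as printed, not derived); the case
`End_Hdg(T) = ℚ` and the Picard-number dichotomy of item `HighPicardSquares`; products `S × S'` of
CM K3 surfaces (Huybrechts, Rem. 3.3). NOTE for route EvenB2Twistor: its items inline the K3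
hypothesis with the clause `Subsingleton (complexBetti S 1)` (`b₁ = 0`) where `IsK3Surface` has
`H¹(S, 𝒪_S) = 0`; the two agree by Hodge symmetry (`b₁ = 2 h^{0,1}`), which is not proved in the
tree, so the fact below is consumed through `IsK3Surface`. Discharge status: OPEN (twistor paths and
hyperholomorphic sheaves, resp. twisted derived categories).
-/

noncomputable section

open CategoryTheory MonoidalCategory
open Literature.AlgebraicGeometry.HodgeTheory

namespace Literature.AlgebraicGeometry.Surfaces

variable {S : Motives.SchemeOver ℂ}

/-- The self-product `S ⊗ S = S ×_ℂ S` of a K3 surface is a smooth projective fourfold (products of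
smooth projective varieties, `Motives.IsSmoothProjective.tensor_holds`), so
`HodgeConjectureFor 4 (S ⊗ S)` is the Hodge conjecture for it.
[cite: Hartshorne1977, III Prop. 10.1 (d) and II Ex. 4.9] -/
theorem IsK3Surface.isSmoothProjective_tensor_self (h : IsK3Surface S) :
    Motives.IsSmoothProjective 4 (S ⊗ S) :=
  Motives.IsSmoothProjective.tensor_holds h.1 h.1

/-- **`S` has complex multiplication**: the endomorphism field `K = End_Hdg(T(S) ⊗ ℚ)` of the
transcendental Hodge structure is a CM field (Huybrechts 2019, Cor. 0.4 (ii); NOT the stronger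
Pjateckiĭ-Šapiro–Šafarevič notion `dim_K T = 1`, Huybrechts' K3 book Rem. 3.3.10). Rendered on the
real carriers, without the transcendental lattice, as: some endomorphism `ψ` of `H²(S(ℂ); ℂ)`
preserving rational classes and Hodge types (a rational Hodge endomorphism) acts on a non-zero class
of type `(2,0)` by a non-real scalar. Equivalent to "`K` is CM" for a complex projective K3 surface:
`H²(S, ℚ) = NS_ℚ ⊕ T_ℚ` with `T_ℚ` irreducible of K3 type (Lemma 3.3.1), so the Hodge
endomorphisms of `T_ℚ` are the `pr_T ∘ ψ|_T` (and extend by `0` on `NS`); `K` is a number field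
embedded in `ℂ` by its action `ε` on `T^{2,0} = H^{2,0}(S)` (Cor. 3.3.6) and is totally real or
CM (Zarhin; Thm. 3.3.7); totally real gives `ε(K) ⊂ ℝ`, CM gives no real embedding, hence `K` is
CM iff some `a ∈ K` acts on `H^{2,0}` by a non-real number.
[cite: Huybrechts2019, Cor. 0.4 (ii) and Rem. 3.3] [cite: Huybrechts2016K3, Lemma 3.3.1, Cor. 3.3.6, Thm. 3.3.7, Rem. 3.3.10]
[cite: Zarhin1983HodgeGroupsK3, Thm. 1.5.1] -/
def HasComplexMultiplication (S : Motives.SchemeOver ℂ) : Prop :=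
  ∃ ψ : complexBetti S 2 →ₗ[ℂ] complexBetti S 2,
    (∀ c, IsRationalClass c → IsRationalClass (ψ c)) ∧
    (∀ p q c, IsOfHodgeType 2 S 2 p q c → IsOfHodgeType 2 S 2 p q (ψ c)) ∧
    ∃ (σ : complexBetti S 2) (μ : ℂ), IsOfHodgeType 2 S 2 2 0 σ ∧ σ ≠ 0 ∧ μ.im ≠ 0 ∧ ψ σ = μ • σ

/-- Unfolding of `HasComplexMultiplication`. [cite: Huybrechts2019, Cor. 0.4 (ii)] -/
theorem hasComplexMultiplication_iff (S : Motives.SchemeOver ℂ) :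
    HasComplexMultiplication S ↔
      ∃ ψ : complexBetti S 2 →ₗ[ℂ] complexBetti S 2,
        (∀ c, IsRationalClass c → IsRationalClass (ψ c)) ∧
        (∀ p q c, IsOfHodgeType 2 S 2 p q c → IsOfHodgeType 2 S 2 p q (ψ c)) ∧
        ∃ (σ : complexBetti S 2) (μ : ℂ), IsOfHodgeType 2 S 2 2 0 σ ∧ σ ≠ 0 ∧ μ.im ≠ 0 ∧
          ψ σ = μ • σ :=
  Iff.rfl

/-- A rational Hodge endomorphism witnessing complex multiplication is not a real scalar multiple of
the identity on `H²` (it has a non-real eigenvalue on `H^{2,0}`). [folklore] -/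
theorem HasComplexMultiplication.exists_ne_real_smul (h : HasComplexMultiplication S) :
    ∃ ψ : complexBetti S 2 →ₗ[ℂ] complexBetti S 2,
      (∀ c, IsRationalClass c → IsRationalClass (ψ c)) ∧ ∀ r : ℝ, ψ ≠ (r : ℂ) • LinearMap.id := by
  obtain ⟨ψ, hrat, -, σ, μ, -, hσ, hμ, hψσ⟩ := h
  refine ⟨ψ, hrat, fun r hr => hμ ?_⟩
  have h1 : μ • σ = (r : ℂ) • σ := by
    rw [← hψσ, hr, LinearMap.smul_apply, LinearMap.id_apply]
  have h2 : μ = (r : ℂ) := smul_left_injective ℂ hσ h1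
  rw [h2, Complex.ofReal_im]

/-- **Buskin's corollary / Huybrechts 2019, Cor. 0.4 (ii): the Hodge conjecture holds for the
self-product of a complex projective K3 surface with complex multiplication.** "If `S` is a complex
projective K3 surface with complex multiplication, i.e. `End_Hdg(T(S) ⊗ ℚ)` is a CM-field, then the
Hodge conjecture holds for `S × S`" — here `HodgeConjectureFor 4 (S ⊗ S)` for the fibre product
`S ⊗ S = S ×_ℂ S` (a smooth projective fourfold, `IsK3Surface.isSmoothProjective_tensor_self`).
Printed proof: a CM endomorphism field is spanned over `ℚ` by Hodge isometries (Zarhin;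
Ramón-Marí), which are algebraic by Buskin's Thm. 1.1 (`Buskin2019_hodgeIsometry_algebraic`), and
the remaining Hodge classes on `S × S` are products of divisors and Künneth factors. Not proved
here. [cite: Buskin2019, Corollary (Introduction, after Thm. 1.1)] [cite: Huybrechts2019, Cor. 0.4 (ii)] -/
def Buskin2019_hodgeConjectureFor_square_of_CM : Prop :=
  ∀ S : Motives.SchemeOver ℂ, IsK3Surface S → HasComplexMultiplication S →
    HodgeConjectureFor 4 (S ⊗ S)

/-- Under the CM corollary, for a CM K3 surface `S` every rational `(p,p)`-class on `S ⊗ S` is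
algebraic (the cycle part of `HodgeConjectureFor 4 (S ⊗ S)`, in every codimension `p`).
[cite: Huybrechts2019, Cor. 0.4 (ii)] -/
theorem mem_algebraicClasses_tensor_self_of_CM (hB : Buskin2019_hodgeConjectureFor_square_of_CM)
    (hS : IsK3Surface S) (hCM : HasComplexMultiplication S) (p : ℕ)
    (c : complexBetti (S ⊗ S) (2 * p)) (hr : IsRationalClass c)
    (hh : IsOfHodgeType 4 (S ⊗ S) (2 * p) p p c) : c ∈ algebraicClasses (S ⊗ S) p :=
  (hB S hS hCM).2 p c hr hh

/-- Under the CM corollary, `S ⊗ S` has a Hodge model whenever `S` is a CM K3 surface (the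
anti-vacuity conjunct of `HodgeConjectureFor`). [cite: Huybrechts2019, Cor. 0.4 (ii)] -/
theorem nonempty_hodgeModel_tensor_self_of_CM (hB : Buskin2019_hodgeConjectureFor_square_of_CM)
    (hS : IsK3Surface S) (hCM : HasComplexMultiplication S) : Nonempty (HodgeModel 4 (S ⊗ S)) :=
  (hB S hS hCM).1

end Literature.AlgebraicGeometry.Surfaces

end
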